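import Mathlib.Analysis.RCLike.Basic
import Mathlib.LinearAlgebra.Matrix.Block
import Mathlib.LinearAlgebra.UnitaryGroup
import HarnessLib

/-!
# An upper triangular unitary matrix with positive real diagonal is the identity
# (uniqueness of the archimedean Iwasawa decomposition `GL_N = B⁺ · U(N)`)

Topic `LinearAlgebra/Matrix`; namespace `Literature.LinearAlgebra.Matrix`.  KERNEL mathematics over Mathlib only: theorems
(no `def`, no named fact, no instance, no notation, no `sorry`).

For `𝕜 = ℝ` or `ℂ` (`RCLike 𝕜`):
* `eq_one_of_blockTriangular_of_mem_unitaryGroup_of_diag_pos` — if `u ∈ M_N(𝕜)` is UPPER TRIANGULAR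
  (`u.BlockTriangular id`), UNITARY (`u ∈ Matrix.unitaryGroup (Fin N) 𝕜`, i.e. `u uᴴ = 1`) and its diagonal entries are
  positive reals, then `u = 1`: `uᴴ = u⁻¹` is upper triangular (inverse of an upper triangular matrix, Mathlib
  `Matrix.blockTriangular_inv_of_blockTriangular`) and lower triangular (adjoint of an upper triangular matrix), so `u` is
  diagonal with `|u_{ii}| = 1` and `u_{ii} > 0`;
* `blockTriangular_mul_unitary_unique` — UNIQUENESS OF THE IWASAWA (Gram–Schmidt, `QR`) DECOMPOSITION: if
  `b k = b′ k′` with `b, b′` upper triangular with positive real diagonals and `k, k′` unitary, then `b = b′` and `k = k′`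
  (`u := b′⁻¹ b = k′ kᴴ` is upper triangular unitary with diagonal `d_i / d′_i > 0`);
* the bookkeeping `mul_apply_diag_of_blockTriangular` (`(X Y)_{ii} = X_{ii} Y_{ii}` for upper triangular `X, Y`),
  `inv_apply_diag_mul_apply_diag` (`(b⁻¹)_{ii} b_{ii} = 1`), `blockTriangular_conjTranspose_toDual` (`Xᴴ` is lower triangular).

This is the uniqueness half of [Knapp2002] Ch. VI §4 Thm. 6.46 (Iwasawa decomposition `G = KAN`, «the decomposition is unique»)
for `GL_N(ℝ)`, `GL_N(ℂ)` read as `G = B⁺K`, and of [Garrett2018] Claim 3.2.1 (`G_v = P_v K_v` at archimedean `v`); the existence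
half is ★ `Literature/NumberTheory/Automorphic/IwasawaDecompositionArchimedean` (`Matrix.exists_blockTriangular_mul_mem_unitaryGroup`).
USE: cell `hodgecm-mathlib`, floor-0 programme P3a, T1-qs row H6b-i (archimedean Iwasawa decomposition of the quasi-split
unitary group `U(J₀)(ℂ) = B·K` by the `θ`-trick, RULING #100a (3)): the «upper ∧ unitary ∧ positive diagonal ⇒ 1» step.
HC_CM is proved only modulo the printed citations until rung 0 closes.

## References
* [Knapp2002] A. W. Knapp, *Lie Groups Beyond an Introduction*, 2nd ed. (2002), Ch. VI §4, Thm. 6.46.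
* [Garrett2018] P. Garrett, *Modern Analysis of Automorphic Forms by Example* (2018), Claim 3.2.1.
-/

set_option autoImplicit false

noncomputable section

open scoped Matrix

namespace Literature.LinearAlgebra.Matrix

/-! ## §1 Diagonal bookkeeping for upper triangular matrices -/

section Triangular

variable {R : Type*} [CommRing R] {N : ℕ}

/-- the diagonal of a product of two UPPER triangular matrices is the product of the diagonals. [cite: Knapp2002, Ch. VI §4, Thm. 6.46] -/
theorem mul_apply_diag_of_blockTriangular {X Y : Matrix (Fin N) (Fin N) R}
    (hX : X.BlockTriangular id) (hY : Y.BlockTriangular id) (i : Fin N) : (X * Y) i i = X i i * Y i i := by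
  rw [Matrix.mul_apply, Finset.sum_eq_single i]
  · intro j _ hji
    rcases lt_or_gt_of_ne hji with h | h
    · rw [hX h, zero_mul]
    · rw [hY h, mul_zero]
  · intro h
    exact absurd (Finset.mem_univ _) h

/-- for an invertible upper triangular `b`: `(b⁻¹)_{ii} · b_{ii} = 1`. [cite: Knapp2002, Ch. VI §4, Thm. 6.46] -/
theorem inv_apply_diag_mul_apply_diag {b : Matrix (Fin N) (Fin N) R} (hb : b.BlockTriangular id) (hdet : IsUnit b.det)
    (i : Fin N) : b⁻¹ i i * b i i = 1 := by
  haveI : Invertible b := Matrix.invertibleOfIsUnitDet b hdet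
  rw [← mul_apply_diag_of_blockTriangular (Matrix.blockTriangular_inv_of_blockTriangular hb) hb i,
    Matrix.nonsing_inv_mul b hdet, Matrix.one_apply_eq]

/-- the conjugate transpose of an upper triangular matrix is lower triangular. [cite: Knapp2002, Ch. VI §4, Thm. 6.46] -/
theorem blockTriangular_conjTranspose_toDual [StarRing R] {X : Matrix (Fin N) (Fin N) R}
    (hX : X.BlockTriangular id) : Xᴴ.BlockTriangular OrderDual.toDual := by
  intro i j hij
  have h : i < j := OrderDual.toDual_lt_toDual.1 hij
  rw [Matrix.conjTranspose_apply, hX h, star_zero]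

end Triangular

/-! ## §2 `B⁺ ∩ U(N) = {1}` and the uniqueness of `g = b k` -/

section Unitary

variable {𝕜 : Type*} [RCLike 𝕜] {N : ℕ}

/-- **An upper triangular UNITARY matrix over `ℝ`/`ℂ` with positive real diagonal is `1`** (`B⁺ ∩ U(N) = {1}`):
`uᴴ = u⁻¹` is upper and lower triangular, so `u` is diagonal with `|u_{ii}| = 1`, `u_{ii} > 0`.
[cite: Knapp2002, Ch. VI §4, Thm. 6.46] -/
theorem eq_one_of_blockTriangular_of_mem_unitaryGroup_of_diag_pos {u : Matrix (Fin N) (Fin N) 𝕜}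
    (hu : u.BlockTriangular id) (hU : u ∈ Matrix.unitaryGroup (Fin N) 𝕜)
    (hd : ∀ i, ∃ r : ℝ, 0 < r ∧ u i i = (r : 𝕜)) : u = 1 := by
  have h1 : star u * u = 1 := Matrix.mem_unitaryGroup_iff'.1 hU
  have h2 : u * star u = 1 := Matrix.mem_unitaryGroup_iff.1 hU
  haveI : Invertible u := ⟨star u, h1, h2⟩
  have hinv : u⁻¹ = star u := Matrix.inv_eq_left_inv h1
  -- `uᴴ = u⁻¹` is upper triangular (inverse of upper) and lower triangular (adjoint of upper)
  have hup : (star u).BlockTriangular id := by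
    rw [← hinv]
    exact Matrix.blockTriangular_inv_of_blockTriangular hu
  -- hence `u` is diagonal
  have hdiag : ∀ i j, i ≠ j → u i j = 0 := by
    intro i j hij
    rcases lt_or_gt_of_ne hij with h | h
    · -- above the diagonal: `(star u) j i = star (u i j) = 0` by upper-triangularity of `star u`
      have h0 : (star u) j i = 0 := hup h
      rw [Matrix.star_eq_conjTranspose, Matrix.conjTranspose_apply] at h0
      simpa using congrArg star h0
    · exact hu h
  -- and its diagonal entries have modulus one and are positive reals, hence `1`
  ext i j
  by_cases hij : i = j
  · subst hij
    obtain ⟨r, hr, hri⟩ := hd i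
    have hii : (star u * u) i i = 1 := by rw [h1, Matrix.one_apply_eq]
    rw [Matrix.mul_apply, Finset.sum_eq_single i] at hii
    · rw [Matrix.star_eq_conjTranspose, Matrix.conjTranspose_apply, hri] at hii
      -- `star r * r = 1` with `r > 0` real ⇒ `r = 1`
      have hrr : (r : 𝕜) * r = 1 := by simpa using hii
      have hr1 : r * r = 1 := by exact_mod_cast hrr
      have : r = 1 := by nlinarith
      rw [Matrix.one_apply_eq, hri, this, RCLike.ofReal_one]
    · intro k _ hki
      rw [hdiag k i hki, mul_zero]
    · intro h
      exact absurd (Finset.mem_univ _) h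
  · rw [Matrix.one_apply_ne hij]
    exact hdiag i j hij

/-- an upper triangular matrix with positive real diagonal has unit determinant (`det = ∏ d_i ≠ 0`). [cite: Knapp2002, Ch. VI §4, Thm. 6.46] -/
theorem isUnit_det_of_blockTriangular_of_diag_pos {b : Matrix (Fin N) (Fin N) 𝕜} (hb : b.BlockTriangular id)
    (hd : ∀ i, ∃ r : ℝ, 0 < r ∧ b i i = (r : 𝕜)) : IsUnit b.det := by
  rw [Matrix.det_of_upperTriangular hb]
  refine IsUnit.mk0 _ (Finset.prod_ne_zero_iff.2 fun i _ => ?_)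
  obtain ⟨r, hr, hri⟩ := hd i
  rw [hri]
  exact_mod_cast hr.ne'

/-- **UNIQUENESS OF THE ARCHIMEDEAN IWASAWA DECOMPOSITION `GL_N(𝕜) = B⁺ · U(N)`**: if `b k = b′ k′` with `b, b′` upper
triangular with positive real diagonals and `k, k′ ∈ U(N)`, then `b = b′` and `k = k′`.
[cite: Knapp2002, Ch. VI §4, Thm. 6.46] -/
theorem blockTriangular_mul_unitary_unique {b b' k k' : Matrix (Fin N) (Fin N) 𝕜}
    (hb : b.BlockTriangular id) (hb' : b'.BlockTriangular id)
    (hd : ∀ i, ∃ r : ℝ, 0 < r ∧ b i i = (r : 𝕜)) (hd' : ∀ i, ∃ r : ℝ, 0 < r ∧ b' i i = (r : 𝕜))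
    (hk : k ∈ Matrix.unitaryGroup (Fin N) 𝕜) (hk' : k' ∈ Matrix.unitaryGroup (Fin N) 𝕜)
    (h : b * k = b' * k') : b = b' ∧ k = k' := by
  have hdet' : IsUnit b'.det := isUnit_det_of_blockTriangular_of_diag_pos hb' hd'
  haveI : Invertible b' := Matrix.invertibleOfIsUnitDet b' hdet'
  have hk1 : k * star k = 1 := Matrix.mem_unitaryGroup_iff.1 hk
  -- `b = b′ k′ kᴴ`
  have hbk : b = b' * (k' * star k) := by
    calc b = b * (k * star k) := by rw [hk1, Matrix.mul_one]
      _ = (b * k) * star k := by rw [Matrix.mul_assoc]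
      _ = (b' * k') * star k := by rw [h]
      _ = b' * (k' * star k) := by rw [Matrix.mul_assoc]
  -- `u := b′⁻¹ b = k′ kᴴ` is unitary, upper triangular, with positive real diagonal
  set u : Matrix (Fin N) (Fin N) 𝕜 := k' * star k with hu
  have huU : u ∈ Matrix.unitaryGroup (Fin N) 𝕜 := Submonoid.mul_mem _ hk' (Unitary.star_mem hk)
  have hu' : u = b'⁻¹ * b := by
    rw [hbk, ← Matrix.mul_assoc, Matrix.nonsing_inv_mul b' hdet', Matrix.one_mul]
  have huT : u.BlockTriangular id := by
    rw [hu']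
    exact (Matrix.blockTriangular_inv_of_blockTriangular hb').mul hb
  have hud : ∀ i, ∃ r : ℝ, 0 < r ∧ u i i = (r : 𝕜) := fun i => by
    obtain ⟨r, hr, hri⟩ := hd i
    obtain ⟨r', hr', hri'⟩ := hd' i
    refine ⟨r / r', div_pos hr hr', ?_⟩
    have hinv : b'⁻¹ i i * b' i i = 1 := inv_apply_diag_mul_apply_diag hb' hdet' i
    rw [hri'] at hinv
    have hinv' : b'⁻¹ i i = ((r' : 𝕜))⁻¹ := by
      have hr0 : (r' : 𝕜) ≠ 0 := by exact_mod_cast hr'.ne'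
      calc b'⁻¹ i i = b'⁻¹ i i * (r' : 𝕜) * ((r' : 𝕜))⁻¹ := by rw [mul_inv_cancel_right₀ hr0]
        _ = ((r' : 𝕜))⁻¹ := by rw [hinv, one_mul]
    rw [hu', mul_apply_diag_of_blockTriangular (Matrix.blockTriangular_inv_of_blockTriangular hb') hb i, hinv', hri,
      RCLike.ofReal_div, div_eq_inv_mul]
  have hu1 : u = 1 := eq_one_of_blockTriangular_of_mem_unitaryGroup_of_diag_pos huT huU hud
  -- conclude
  have hbb : b = b' := by rw [hbk, hu1, Matrix.mul_one]
  refine ⟨hbb, ?_⟩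
  -- cancel `b = b′` (invertible) in `b k = b′ k′`
  have h' : b' * k = b' * k' := by rw [← hbb]; nth_rewrite 2 [hbb]; exact h
  calc k = b'⁻¹ * (b' * k) := by rw [← Matrix.mul_assoc, Matrix.nonsing_inv_mul b' hdet', Matrix.one_mul]
    _ = b'⁻¹ * (b' * k') := by rw [h']
    _ = k' := by rw [← Matrix.mul_assoc, Matrix.nonsing_inv_mul b' hdet', Matrix.one_mul]

end Unitary

end Literature.LinearAlgebra.Matrix
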